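import Summits.Ventures.PercRepro.MSLemmaX
import Summits.Ventures.PercRepro.MSMinLost

/-!
# (MIN) in Lemma X's vocabulary — the bridge from the cube theorem to the lane

Dossier proofs/MINE1-theoremS.md, Addendum 57 suppl. 8 and Addendum 58. Lemma X's setting
(MSLemmaX.lean): `U ⊇ U₀` upper sets of `Finset α`, `T ⊆ U₀`, `D = cofam U₀`, the lost sets
`lostSet U U₀ T` and their up-closure `lostUp U U₀ T`. At EXACT EXCESS `|U₀ ∖ T| = |Lost| + 1`
the cube theorem `crossSet_eq_singleton` (MSMinLost.lean) applies with `G = univ`,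
`D = cofam U₀`, `A = lostUp U U₀ T` and `c = univ ∖ y₁` for any `y₁ ∈ U ∖ U₀` (the lane's UC
witness; `hypH_lost`), and gives **(MIN)**: for a MINIMAL lost set `z`, the members `y ∈ U₀` with
`z ⊆ y` and `y ∖ z ∉ U₀` are exactly `{y₁ ∪ z}` (`filter_lost_eq_singleton`,
`card_filter_lost_eq_one`) — Addendum 57 suppl. 8's `exc_z = 1`, the residual of shape A of
`SingCaseIResidue α`.
-/

namespace PercRepro.MSTight

open Finset

variable {α : Type*} [DecidableEq α]

section Bridge

variable [Fintype α] {U U₀ T : Finset (Finset α)} {y₁ z : Finset α}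

/-- The cube framework at `G = univ`: `cofG univ` is `cofam`. -/
theorem cofG_univ_eq_cofam (A : Finset (Finset α)) : cofG univ A = cofam A := rfl

/-- `cofam U₀` is a down-set of the full cube. -/
theorem isLowerIn_univ_cofam (hU₀ : IsUpperSet (U₀ : Set (Finset α))) :
    IsLowerIn univ (cofam U₀) :=
  ⟨fun v _ => subset_univ v, isLowerSet_cofam hU₀⟩

/-- `lostUp U U₀ T` is an up-set of the full cube. -/
theorem isUpperIn_univ_lostUp : IsUpperIn univ (lostUp U U₀ T) :=
  ⟨fun a _ => subset_univ a, fun _ ha _ hat _ => isUpperSet_lostUp hat ha⟩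

/-- With `U ∖ U₀` nonempty, `∅` is not lost. -/
theorem empty_notMem_lostUp (hy₁ : y₁ ∈ U \ U₀) : ∅ ∉ lostUp U U₀ T := by
  intro h
  obtain ⟨z, hz, hze⟩ := mem_lostUp.1 h
  rw [subset_empty] at hze
  subst hze
  obtain ⟨hy₁U, hy₁U₀⟩ := mem_sdiff.1 hy₁
  exact hy₁U₀ (mem_sdiff.1 ((mem_lostSet.1 hz).2 y₁ hy₁U (empty_subset y₁))).1

/-- A minimal member of `↑Lost` is a lost set. -/
theorem mem_lostSet_of_isMinIn (hz : IsMinIn (lostUp U U₀ T) z) : z ∈ lostSet U U₀ T := by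
  obtain ⟨z', hz', hz'z⟩ := mem_lostUp.1 hz.1
  have := hz.2 z' (mem_lostUp.2 ⟨z', hz', Subset.refl z'⟩) hz'z
  rwa [← this]

/-- `univ ∖ (a ∪ b) = (univ ∖ a) ∖ b`. -/
theorem univ_sdiff_union (a b : Finset α) : univ \ (a ∪ b) = (univ \ a) \ b := by
  ext x; simp [not_or]

/-- `univ ∖ ((univ ∖ a) ∪ b) = a ∖ b`. -/
theorem univ_sdiff_sdiff_union (a b : Finset α) : univ \ ((univ \ a) ∪ b) = a \ b := by
  ext x; simp [not_or]

/-- `univ ∖ (a ∖ b) = (univ ∖ a) ∪ b`. -/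
theorem univ_sdiff_sdiff (a b : Finset α) : univ \ (a \ b) = (univ \ a) ∪ b := by
  ext x; simp only [mem_sdiff, mem_univ, mem_union, true_and, not_and, not_not]; tauto

/-- (H) holds for `c = univ ∖ y₁`, `y₁ ∈ U ∖ U₀`. -/
theorem hypH_lost (hU : IsUpperSet (U : Set (Finset α))) (hU₀ : IsUpperSet (U₀ : Set (Finset α)))
    (hy₁ : y₁ ∈ U \ U₀) : HypH (cofam U₀) (lostUp U U₀ T) (univ \ y₁) := by
  intro z hz
  have hzL := mem_lostSet_of_isMinIn hz
  obtain ⟨hy₁U, hy₁U₀⟩ := mem_sdiff.1 hy₁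
  constructor
  · rw [← univ_sdiff_union, mem_cofam]
    refine ⟨y₁ ∪ z, ?_, rfl⟩
    have h1 : y₁ ∪ z ∈ U := hU subset_union_left hy₁U
    exact (mem_sdiff.1 ((mem_lostSet.1 hzL).2 _ h1 subset_union_right)).1
  · intro h
    rw [mem_cofam] at h
    obtain ⟨y, hy, hyeq⟩ := h
    have : y = y₁ \ z := by
      rw [← Finset.sdiff_sdiff_eq_self (subset_univ y), hyeq, univ_sdiff_sdiff_union]
    subst this
    exact hy₁U₀ (hU₀ sdiff_subset hy)

/-- A lost set minimal among the lost sets is a minimal member of `lostUp`. -/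
theorem isMinIn_lostUp_of_min (hz : z ∈ lostSet U U₀ T)
    (hmin : ∀ z' ∈ lostSet U U₀ T, z' ⊆ z → z' = z) : IsMinIn (lostUp U U₀ T) z := by
  refine ⟨mem_lostUp.2 ⟨z, hz, Subset.refl z⟩, fun y hy hyz => ?_⟩
  obtain ⟨z', hz', hz'y⟩ := mem_lostUp.1 hy
  have := hmin z' hz' (hz'y.trans hyz)
  subst this
  exact Subset.antisymm hyz hz'y

/-- Exact excess `|R| = |Lost| + 1` gives excess one in the cube. -/
theorem exc_univ_eq_one (hU : IsUpperSet (U : Set (Finset α))) (hU₀ : IsUpperSet (U₀ : Set (Finset α)))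
    (hU₀U : U₀ ⊆ U) (hy₁ : y₁ ∈ U \ U₀)
    (hexact : (U₀ \ T).card = (lostSet U U₀ T).card + 1)
    (hz : z ∈ lostSet U U₀ T) (hmin : ∀ z' ∈ lostSet U U₀ T, z' ⊆ z → z' = z) :
    exc univ (cofam U₀) (lostUp U U₀ T) = 1 := by
  have hzmin := isMinIn_lostUp_of_min hz hmin
  have hge := one_le_exc_of_crossSet_nonempty (isLowerIn_univ_cofam hU₀) isUpperIn_univ_lostUp hzmin
    ⟨_, (hypH_lost hU hU₀ hy₁).sdiff_mem_crossSet hzmin⟩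
  have hle : exc univ (cofam U₀) (lostUp U U₀ T) ≤ 1 := by
    unfold exc
    rw [cofG_univ_eq_cofam, ← card_inter_lostUp_eq, cofam_inter_lostUp]
    have := card_le_card (inter_lostUp_subset (T := T) hU₀U)
    omega
  omega

/-- **(MIN) in Lemma X's vocabulary** (Addendum 57 suppl. 8 / Addendum 58): at exact excess
`|U₀ ∖ T| = |Lost| + 1`, for a MINIMAL lost set `z` and any `y₁ ∈ U ∖ U₀`, the members of `U₀`
containing `z` whose `z`-free part leaves `U₀` are exactly `{y₁ ∪ z}`. -/
theorem filter_lost_eq_singleton (hU : IsUpperSet (U : Set (Finset α)))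
    (hU₀ : IsUpperSet (U₀ : Set (Finset α))) (hU₀U : U₀ ⊆ U) (hy₁ : y₁ ∈ U \ U₀)
    (hexact : (U₀ \ T).card = (lostSet U U₀ T).card + 1)
    (hz : z ∈ lostSet U U₀ T) (hmin : ∀ z' ∈ lostSet U U₀ T, z' ⊆ z → z' = z) :
    U₀.filter (fun y => z ⊆ y ∧ y \ z ∉ U₀) = {y₁ ∪ z} := by
  have hzmin := isMinIn_lostUp_of_min hz hmin
  have key := crossSet_eq_singleton (isLowerIn_univ_cofam hU₀) isUpperIn_univ_lostUp
    (empty_notMem_lostUp hy₁) (subset_univ _) (hypH_lost hU hU₀ hy₁)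
    (exc_univ_eq_one hU hU₀ hU₀U hy₁ hexact hz hmin) hzmin
  ext y
  rw [mem_filter, mem_singleton]
  have hcross : univ \ y ∈ crossSet (cofam U₀) z ↔ y ∈ U₀ ∧ z ⊆ y ∧ y \ z ∉ U₀ := by
    rw [mem_crossSet]
    constructor
    · rintro ⟨hv, hdisj, hvz⟩
      rw [mem_cofam] at hv
      obtain ⟨y', hy', hy'e⟩ := hv
      have : y' = y := by
        rw [← Finset.sdiff_sdiff_eq_self (subset_univ y'), hy'e, Finset.sdiff_sdiff_eq_self (subset_univ y)]
      subst this
      refine ⟨hy', ?_, ?_⟩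
      · intro x hxz
        by_contra hxy
        exact disjoint_left.1 hdisj (mem_sdiff.2 ⟨mem_univ x, hxy⟩) hxz
      · intro h
        apply hvz
        rw [mem_cofam]
        exact ⟨y' \ z, h, univ_sdiff_sdiff y' z⟩
    · rintro ⟨hy, hzy, hyz⟩
      refine ⟨mem_cofam.2 ⟨y, hy, rfl⟩, ?_, ?_⟩
      · rw [disjoint_left]
        intro x hx hxz
        exact (mem_sdiff.1 hx).2 (hzy hxz)
      · intro h
        rw [mem_cofam] at h
        obtain ⟨y', hy', hy'e⟩ := h
        have : y' = y \ z := by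
          rw [← Finset.sdiff_sdiff_eq_self (subset_univ y'), hy'e, univ_sdiff_sdiff_union]
        subst this
        exact hyz hy'
  rw [← hcross, key, mem_singleton, ← univ_sdiff_union]
  constructor
  · intro h
    rw [← Finset.sdiff_sdiff_eq_self (subset_univ y), h, Finset.sdiff_sdiff_eq_self (subset_univ _)]
  · rintro rfl
    rfl

/-- The count: exactly one such member. -/
theorem card_filter_lost_eq_one (hU : IsUpperSet (U : Set (Finset α)))
    (hU₀ : IsUpperSet (U₀ : Set (Finset α))) (hU₀U : U₀ ⊆ U) (hy₁ : y₁ ∈ U \ U₀)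
    (hexact : (U₀ \ T).card = (lostSet U U₀ T).card + 1)
    (hz : z ∈ lostSet U U₀ T) (hmin : ∀ z' ∈ lostSet U U₀ T, z' ⊆ z → z' = z) :
    (U₀.filter (fun y => z ⊆ y ∧ y \ z ∉ U₀)).card = 1 := by
  rw [filter_lost_eq_singleton hU hU₀ hU₀U hy₁ hexact hz hmin, card_singleton]

/-- **(A∩′)** (Addendum 57 suppl. 6–8, in the form the lane uses): at exact excess, let `u ∈ U`
contain a minimal lost set `z`, and let the «A-cell» `(univ ∖ u) ∪ z` be a member of `U` while
`univ ∖ u ∉ U₀`. Then `u ∖ z ∈ U₀`. (Only the existence of some `y₁ ∈ U ∖ U₀` is needed.) -/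
theorem sdiff_mem_of_lost (hU : IsUpperSet (U : Set (Finset α)))
    (hU₀ : IsUpperSet (U₀ : Set (Finset α))) (hU₀U : U₀ ⊆ U) (hU₁ : (U \ U₀).Nonempty)
    (hexact : (U₀ \ T).card = (lostSet U U₀ T).card + 1)
    (hz : z ∈ lostSet U U₀ T) (hmin : ∀ z' ∈ lostSet U U₀ T, z' ⊆ z → z' = z) {u : Finset α}
    (hu : u ∈ U) (hzu : z ⊆ u) (hg : (univ \ u) ∪ z ∈ U) (hnot : univ \ u ∉ U₀) :
    u \ z ∈ U₀ := by
  obtain ⟨y₁, hy₁⟩ := hU₁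
  have key := filter_lost_eq_singleton hU hU₀ hU₀U hy₁ hexact hz hmin
  have hzL := mem_lostSet.1 hz
  -- `g₂ := (univ ∖ u) ∪ z` lies in the filter
  have hg₂ : (univ \ u) ∪ z ∈ U₀.filter (fun y => z ⊆ y ∧ y \ z ∉ U₀) := by
    rw [mem_filter]
    refine ⟨(mem_sdiff.1 (hzL.2 _ hg subset_union_right)).1, subset_union_right, ?_⟩
    have : ((univ \ u) ∪ z) \ z = univ \ u := by
      rw [union_sdiff_right]
      exact sdiff_eq_left.2 (disjoint_sdiff_self_left.mono_right hzu)
    rw [this]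
    exact hnot
  rw [key, mem_singleton] at hg₂
  by_contra h
  have huU₀ : u ∈ U₀ := (mem_sdiff.1 (hzL.2 u hu hzu)).1
  have hmem : u ∈ U₀.filter (fun y => z ⊆ y ∧ y \ z ∉ U₀) := mem_filter.2 ⟨huU₀, hzu, h⟩
  rw [key, mem_singleton] at hmem
  -- `u = y₁ ∪ z = (univ ∖ u) ∪ z` forces `u = univ`
  have huniv : u = univ := by
    apply eq_univ_of_forall
    intro x
    by_cases hxu : x ∈ u
    · exact hxu
    · have : x ∈ (univ \ u) ∪ z := mem_union_left _ (mem_sdiff.2 ⟨mem_univ x, hxu⟩)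
      rw [hg₂, ← hmem] at this
      exact absurd this hxu
  apply h
  obtain ⟨y, hy, hyz⟩ := mem_cofam.1 (lostSet_subset hz)
  rw [huniv, ← hyz, Finset.sdiff_sdiff_eq_self (subset_univ y)]
  exact hy

end Bridge

end PercRepro.MSTight
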